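import Summits.BirchSwinnertonDyer.BirchSwinnertonDyer.Theorems.PrintCf2RubinValueTwoKatoUnitRepNormRelation
import Summits.BirchSwinnertonDyer.BirchSwinnertonDyer.Theorems.PrintCf2RubinValueTwoTwistedKummerScalar
import Literature.NumberTheory.EllipticCurves.Kato2004.UnitTowerOfCorrectedReps
import Literature.NumberTheory.EllipticCurves.Kato2004.RayClassFieldTorsionField
import Literature.NumberTheory.EllipticCurves.Kato2004.EllipticUnitKummerCupValues
import Literature.NumberTheory.ComplexMultiplication.EllipticUnits.KatoEllipticUnitRepresentatives
import Literature.NumberTheory.ComplexMultiplication.EllipticUnits.KatoLayerArtinCompatibility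
import HarnessLib

/-!
# (F∃)-2b — the UNIT TOWER OF KATO'S ELLIPTIC UNITS `_𝔞z_{pˢ𝔣}` on the torsion-tower Kummer frame of a CM curve:
# `exists_unitTower_of_katoReps` (the unit-tower conjunct of `hF` in `CM.prop159_ellipticUnits_expStar_values_of_kummerCup`)

Cell `bsd-cm` (HOME `run/shared/lean/pub/bsd-cm/`), seat `bsd-cm-k-ty1` g31, row K2C-11 / (F∃)_K part 2b; pen rulings D1043 (3)–(4),
D1045 (5) (signature of record), D1046 (C) (split F∃-2a Literature / F∃-2b Summit), D1053 (2) (an `_of_reps` form with the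
representatives as PARAMETERS, so that the K2C-16 constructor feeds the SAME units to the genus side `θu` and to the Kummer tower),
D1057.  Crux `EllipticUnitValueSevenOfGZK` (stmt-BirchSwinnertonDyer-19945, route K7r); general in `K, A, p, f` (the pinned frame
uses `p = 7`, `K = ℚ(√−7)`).  THEOREMS ONLY (no `def`, no named fact, no `instance`, no notation, no `sorry`); CONDITIONAL on the named
facts it displays: de Shalit II.2.5 (i) / II.2.4 (i) (`DeShalit1987.prop25_i_normRelation`, `prop24_i_mem_rayClassField`), the CM
field identification (M1) `CM.rayClassField_le_torsionField` / (M1′) `CM.torsionField_le_rayClassField_of_conductor`, and — in the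
`hE` forms only — Kato §15.5 (`Kato2004.sec155_exists_katoUnitRep`).

WHAT.  For `A/ℚ` with CM by the maximal order of the imaginary quadratic field `K` (`A.j ∈ maximalCMJInvariants`,
`IsCMFieldOfJ K A.j`), a Hecke character `ψ` with `L(ψ, s) = L(A, s)` whose conductor divides `(f)` (`f ≥ 1`, stated as in `h159`
through a complex embedding `ι₀ : K → ℂ` and its chosen extension `algClosureEmb ι₀`), a prime `p ∤ 12` with every level `pˢ𝔣`
(`s ≥ 1`) rigid (`UnitsInjectiveMod`), an admissible twist `𝔞` (`IsTwist p (f) 𝔞`), and ANY Kummer frame `F` of `A_K` at `p` on the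
ray-class tower (`F.V s = Gal(K̄/K(A_K[pˢf]))`, e.g. `KummerFrame.ofTorsionTower`): from level representatives `r s` of Kato's
units (`IsKatoUnitRep p ι₀ (f) s 𝔞 (r s)`, `s ≥ 1`) we build a `KummerFrame.UnitTower u` on `F` with `u.z 1 = r 1` and
`u.z s = η_s · r s`, `η_s^{12} = 1`, `η_s ∈ K(pˢ𝔣)` — hence `u.z s` is again a Kato representative (`IsKatoUnitRep`, and
`CM.IsKatoUnitRepAt p (algClosureEmb ι₀)`) at every `s ≥ 1` (§3 `exists_unitTower_of_katoReps_of_frame_of_reps`,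
`exists_unitTower_of_katoReps_of_reps`); the `hE` forms choose the representatives from `Kato2004.sec155_exists_katoUnitRep`
(§4 `exists_unitTower_of_katoReps_of_frame`, ★ `exists_unitTower_of_katoReps` = the D1045 (5) letter).

HOW (README-g30 §2(a) recipe; the three hypotheses of the Literature theorem `KummerFrame.exists_unitTower_of_reps` (F∃-2a)):
the levels are `F.V s = torsionLayer A_K (pˢf) = Gal(K̄/K(pˢ𝔣)) = galFixing K (katoLayer p (f) s)` by (M1)+(M1′)
(`CM.torsionLayer_eq_fixingSubgroup_katoLayer`) and §1 `galFixing_eq_fixingSubgroup`; so `hr_fix` is «`r s ∈ K(pˢ𝔣)`» (the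
`pUnitsOf` conjunct of `IsKatoUnitRep`); `hr_int` is the `p`-unit conjunct verbatim; `hr_norm` — the one real step — reads the
frame's coset norm `∏_{x ∈ V s ⧸ V (s+1)} (out x) • r (s+1)` (`KummerFrame.coe_cosetNorm_eq_prod_smul`, any section) as the field norm
`normOver (K(p^{s+1}𝔣)) (K(pˢ𝔣))` through the Summit bridge `prod_smul_eq_normOver_of_eq` (the coset space of
`Gal(K̄/K_s) ⧸ Gal(K̄/K_{s+1})` with `Quotient.out` representatives ↦ `Gal(K_{s+1}/K_s)`), and then de Shalit II.2.5 (i) in the form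
`exists_normOver_katoUnitRep_eq_mul` gives `N(r (s+1)) = ζ · r s`, `ζ^{12} = 1`; the indices `[V s : V (s+1)]` are `p`-powers
(`coprime_card_quotient_torsionLayer`).  The conclusion's `η_s ∈ K(pˢ𝔣)` is Krull (`§1 mem_of_forall_galFixing_smul_eq`) and
`IsKatoUnitRep` is stable under such `η` (§1 `isKatoUnitRep_mul_of_pow_twelve`).

HONEST DELTAS vs the `hF` letter of `CM.prop159_ellipticUnits_expStar_values_of_kummerCup` (the pen's H159′-SWAP bookkeeping, not
closed here): (δ1) the pin is at the CHOSEN extension `algClosureEmb ι₀` of `ι₀`, while `hF` quantifies over every `ι : K̄ → ℂ`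
extending the infinite place; (δ2) `𝔞` ranges over admissible twists `IsTwist p (f) 𝔞` (prime to `6p𝔣` AND `𝔞 ≠ O_K`), while `hF`
asks `IsCoprime 𝔞 (6pf)` only; (δ3) hypotheses `IsImaginaryQuadratic K`, `p.Coprime 12`, rigidity `hrig` at all levels `≥ 1`,
`0 < f` (vs `3 ≤ f`).  HONEST FRAMING: Galois/unit bookkeeping conditional on displayed named facts; proves nothing about BSD or
about any particular curve; closes no stub; no summit statement is proved.

## References

* [Kato2004Asterisque] K. Kato, Astérisque 295 (2004), §15.5 (p. 253: `_𝔞z_𝔣 := _𝔞θ_E(α) ∈ K(𝔣)^×`; «the norm map of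
  `K(p^{n+1}𝔣)/K(pⁿ𝔣)` sends `_𝔞z_{p^{n+1}𝔣}` to `_𝔞z_{pⁿ𝔣}`»), §15.3 (15.3.1)–(15.3.3) (p. 252), §15.1 (p. 251).
* [deShalit1987] E. de Shalit, *Iwasawa Theory of Elliptic Curves with Complex Multiplication* (1987), II.1.6, II.2.3 (10),
  II.2.4 (i)–(iii), II.2.5 Proposition (i).
* [JohnsonLeungKings2011] J. Johnson-Leung, G. Kings (2011), Prop. 3.3 (1)(2), Def. 3.5.
* [SilvermanATAEC1994] J. H. Silverman, *Advanced Topics in the Arithmetic of Elliptic Curves* (1994), Ch. II Thm. 5.6.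
* [NeukirchANT1999] J. Neukirch, *Algebraic Number Theory* (1999), Ch. IV §1 (Krull topology, `K̄^{Gal(K̄/L)} = L`).
-/

noncomputable section

open scoped NumberField
open Field NumberField IsDedekindDomain
open Literature.NumberTheory.GaloisRepresentations Literature.NumberTheory.GaloisRepresentations.LocalWeilDatum
open Literature.NumberTheory.EllipticCurves
open Literature.NumberTheory.EllipticCurves.Kato2004
open Literature.NumberTheory.ComplexMultiplication.EllipticUnits
open Summit.BirchSwinnertonDyer.BirchSwinnertonDyer.Theorems.PrintCf2.KatoUnitRepNorm
open Summit.BirchSwinnertonDyer.BirchSwinnertonDyer.Theorems.PrintCf2.TwistedZeta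

namespace Summit.BirchSwinnertonDyer.Rank1Residual.Additive.GenusSeven.KummerUnitTower

section Generic

variable {K : Type} [Field K] [NumberField K]

/-! ## §1 Three generic lemmas: `Gal(K̄/L)` as `galFixing`, Krull descent, and the `μ₁₂`-stability of `IsKatoUnitRep` -/

omit [NumberField K] in
/-- Mathlib's `L.fixingSubgroup ≤ Aut_K(K̄)`, read in `Γ_K = absoluteGaloisGroup K`, is the tree's `galFixing K L` (the identity
`absoluteGaloisGroup.toAlgEquiv`). [cite: NeukirchANT1999, Ch. IV §1] -/
theorem galFixing_eq_fixingSubgroup (L : IntermediateField K (AlgebraicClosure K)) :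
    galFixing K L = (L.fixingSubgroup : Subgroup (absoluteGaloisGroup K)) := by
  ext σ
  rw [mem_galFixing_iff]
  exact (IntermediateField.mem_fixingSubgroup_iff L (absoluteGaloisGroup.toAlgEquiv K σ)).symm

/-- **Krull descent**: an element of `K̄` fixed by `Gal(K̄/L)` lies in `L` (`K̄^{Gal(K̄/L)} = L`,
`InfiniteGalois.fixedField_fixingSubgroup`). [cite: NeukirchANT1999, Ch. IV §1 Thm. (1.2)] -/
theorem mem_of_forall_galFixing_smul_eq {L : IntermediateField K (AlgebraicClosure K)} {x : AlgebraicClosure K}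
    (h : ∀ σ ∈ galFixing K L, σ • x = x) : x ∈ L := by
  rw [← InfiniteGalois.fixedField_fixingSubgroup L, IntermediateField.mem_fixedField_iff]
  intro g hg
  have hσ : (absoluteGaloisGroup.toAlgEquiv K).symm g ∈ galFixing K L :=
    (mem_galFixing_iff K).mpr fun y hy ↦ (IntermediateField.mem_fixingSubgroup_iff L g).mp hg y hy
  exact h _ hσ

/-- **`IsKatoUnitRep` is stable under twelfth roots of unity of the layer**: if `u` represents `_𝔞z_{pⁿ𝔣}` (`u ∈ O_{K_n}[1/p]^×`,
`ι̂(u)^{12} = Θ(1; pⁿ𝔣, 𝔞)`) and `η ∈ K_n = K(pⁿ𝔣)` with `η^{12} = 1`, then so does `η·u` — Kato's `_𝔞z` is `_𝔞θ_E(α)`, a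
twelfth root of de Shalit's `Θ`, determined up to `μ₁₂`. [cite: Kato2004Asterisque, §15.5 (p. 253)] [cite: deShalit1987, II.2.3
(10) and II.2.4 (iii)] [cite: JohnsonLeungKings2011, Prop. 3.3 (1)] -/
theorem isKatoUnitRep_mul_of_pow_twelve (p : ℕ) {ι : K →+* ℂ} {𝔣 : Ideal (𝓞 K)} {n : ℕ} {𝔞 : Ideal (𝓞 K)}
    {η u : (AlgebraicClosure K)ˣ} (hη : η ^ 12 = 1) (hηL : (η : AlgebraicClosure K) ∈ katoLayer p 𝔣 n)
    (hu : IsKatoUnitRep p ι 𝔣 n 𝔞 u) : IsKatoUnitRep p ι 𝔣 n 𝔞 (η * u) := by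
  obtain ⟨hmem, hθ⟩ := hu
  have hη' : η⁻¹ ^ 12 = 1 := by rw [inv_pow, hη, inv_one]
  refine ⟨Subgroup.mul_mem _ ⟨hηL, 0, ?_, ?_⟩ hmem, ?_⟩
  · rw [pow_zero, one_mul]
    exact KummerFrame.isIntegral_of_pow_twelve_eq_one hη
  · rw [pow_zero, one_mul]
    exact KummerFrame.isIntegral_of_pow_twelve_eq_one hη'
  · rwa [Units.val_mul, mul_pow, ← Units.val_pow_eq_pow_val, hη, Units.val_one, one_mul]

end Generic

/-! ## §2 The levels of a frame on the ray-class tower are `Gal(K̄/K(pˢ𝔣)) = galFixing K (katoLayer p (f) s)` -/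

section Frame

/-- **`V s = galFixing K (K(pˢ𝔣))`** for a Kummer frame on the ray-class tower of the CM curve `A_K`
(`V s = Gal(K̄/K(A_K[pˢf]))`; (M1)+(M1′): `K(A_K[pˢf]) = K(pˢ𝔣)` for `cond ψ ∣ (f)`). [cite: deShalit1987, II.1.6 Proposition]
[cite: SilvermanATAEC1994, Ch. II Thm. 5.6] [cite: Kato2004Asterisque, §15.3 (15.3.1)–(15.3.3) (p. 252)] -/
theorem V_eq_galFixing_katoLayer
    (hM1 : CM.rayClassField_le_torsionField) (hM1' : CM.torsionField_le_rayClassField_of_conductor)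
    (A : WeierstrassCurve ℚ) [A.IsElliptic] (hA : A.j ∈ maximalCMJInvariants)
    (K : Type) [Field K] [NumberField K] (hK : IsCMFieldOfJ K A.j)
    (ψ : HeckeCharacter K) (hψA : ∀ z : ℂ, 3 / 2 < z.re → heckeLFunction ψ z = A.LSeries z)
    (ι₀ : K →+* ℂ) (f : ℕ) (hf : 0 < f)
    (hcond : ∀ α : 𝓞 K, α ≠ 0 → ((f : ℕ) : 𝓞 K) ∣ α - 1 →
      CM.heckeCharIdealValue ψ (Ideal.span {α}) = algClosureEmb ι₀ (algebraMap K (AlgebraicClosure K) (α : K)))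
    (p : ℕ) [Fact p.Prime]
    (F : KummerFrame (A.baseChange K) p)
    (hFV : ∀ s : ℕ, F.V s = CM.torsionLayer (A.baseChange K) (p ^ s * f)) (s : ℕ) :
    F.V s = galFixing K (katoLayer p (Ideal.span {((f : ℕ) : 𝓞 K)}) s) := by
  rw [hFV s, CM.torsionLayer_eq_fixingSubgroup_katoLayer hM1 hM1' A hA K hK ψ hψA (algClosureEmb ι₀) f hf.ne' hcond p f
    hf.ne' (dvd_refl f) s]
  exact (galFixing_eq_fixingSubgroup _).symm

/-- **The indices `[V s : V (s+1)]` of a frame on the ray-class tower are prime to `12`** for `p ∤ 12` and `s ≥ 1`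
(`[Gal(K̄/K(A_K[pˢf])) : Gal(K̄/K(A_K[p^{s+1}f]))]` is a `p`-power, `Kato2004.coprime_card_quotient_torsionLayer`).
[cite: deShalit1987, II.1.7 Corollary] [cite: Kato2004Asterisque, §15.3 (15.3.1) (p. 252)] -/
theorem coprime_card_quotient_of_frame {K : Type} [Field K] [NumberField K] (E : WeierstrassCurve K) [E.IsElliptic]
    (f : ℕ) (hf : 0 < f) (p : ℕ) [Fact p.Prime] (hp : p.Coprime 12) (F : KummerFrame E p)
    (hFV : ∀ s : ℕ, F.V s = CM.torsionLayer E (p ^ s * f)) {s : ℕ} (hs : 1 ≤ s) :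
    (Nat.card (F.V s ⧸ (F.V (s + 1)).subgroupOf (F.V s))).Coprime 12 := by
  have hp' : p.Prime := Fact.out
  have hmul : p ^ (s + 1) * f = p * (p ^ s * f) := by rw [pow_succ]; ring
  rw [hFV s, hFV (s + 1), hmul]
  exact coprime_card_quotient_torsionLayer E p (mul_ne_zero (pow_ne_zero s hp'.ne_zero) hf.ne')
    (dvd_mul_of_dvd_left (dvd_pow_self p (by omega)) f) hp

/-! ## §3 The unit tower from GIVEN representatives (`_of_reps` forms, pen D1053 (2)) -/

/-- **The unit tower of Kato's elliptic units on ANY frame of the ray-class tower, from given representatives.**  For level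
representatives `r s` of `_𝔞z_{pˢ𝔣}` (`IsKatoUnitRep p ι₀ (f) s 𝔞 (r s)`, `s ≥ 1`; `K` imaginary quadratic, every level `pˢ𝔣`
rigid, `𝔞` an admissible twist, `p ∤ 12`) and any Kummer frame `F` of `A_K` at `p` with `F.V s = Gal(K̄/K(A_K[pˢf]))`: there is a
unit tower `u` on `F` (exact norm relation, `p`-units — `KummerFrame.UnitTower`) with `u.z 1 = r 1` and, for every `s ≥ 1`,
`u.z s = η · r s` for some `η ∈ K(pˢ𝔣)` with `η^{12} = 1`; consequently `u.z s` is again a representative of `_𝔞z_{pˢ𝔣}`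
(`IsKatoUnitRep p ι₀`, equivalently `CM.IsKatoUnitRepAt p (algClosureEmb ι₀)`).  Inputs: de Shalit II.2.5 (i) / II.2.4 (i) (norm
relation up to `μ₁₂`, `exists_normOver_katoUnitRep_eq_mul`), (M1)+(M1′) (the levels are `Gal(K̄/K(pˢ𝔣))`), and the Literature
`μ₁₂`-correction `KummerFrame.exists_unitTower_of_reps`. [cite: Kato2004Asterisque, §15.5 (p. 253)] [cite: deShalit1987, II.2.5
Proposition (i), II.2.4 (i)(iii), II.1.6] [cite: JohnsonLeungKings2011, Prop. 3.3 (1)(2)] -/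
theorem exists_unitTower_of_katoReps_of_frame_of_reps
    (h25 : DeShalit1987.prop25_i_normRelation) (h24i : DeShalit1987.prop24_i_mem_rayClassField)
    (hM1 : CM.rayClassField_le_torsionField) (hM1' : CM.torsionField_le_rayClassField_of_conductor)
    (A : WeierstrassCurve ℚ) [A.IsElliptic] (hA : A.j ∈ maximalCMJInvariants)
    (K : Type) [Field K] [NumberField K] (hK : IsCMFieldOfJ K A.j) (hKiq : IsImaginaryQuadratic K)
    (ψ : HeckeCharacter K) (hψA : ∀ z : ℂ, 3 / 2 < z.re → heckeLFunction ψ z = A.LSeries z)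
    (ι₀ : K →+* ℂ) (f : ℕ) (hf : 0 < f)
    (hcond : ∀ α : 𝓞 K, α ≠ 0 → ((f : ℕ) : 𝓞 K) ∣ α - 1 →
      CM.heckeCharIdealValue ψ (Ideal.span {α}) = algClosureEmb ι₀ (algebraMap K (AlgebraicClosure K) (α : K)))
    (p : ℕ) [Fact p.Prime] (hp : p.Coprime 12)
    (hrig : ∀ n : ℕ, 1 ≤ n → UnitsInjectiveMod (katoModulus p (Ideal.span {((f : ℕ) : 𝓞 K)}) n))
    (F : KummerFrame (A.baseChange K) p) (hFV : ∀ s : ℕ, F.V s = CM.torsionLayer (A.baseChange K) (p ^ s * f))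
    (𝔞 : Ideal (𝓞 K)) (h𝔞 : IsTwist p (Ideal.span {((f : ℕ) : 𝓞 K)}) 𝔞)
    (r : ℕ → (AlgebraicClosure K)ˣ) (hr : ∀ s : ℕ, 1 ≤ s → IsKatoUnitRep p ι₀ (Ideal.span {((f : ℕ) : 𝓞 K)}) s 𝔞 (r s)) :
    ∃ u : F.UnitTower, u.z 1 = r 1 ∧ ∀ s : ℕ, 1 ≤ s →
      (∃ η : (AlgebraicClosure K)ˣ, η ^ 12 = 1 ∧
        (η : AlgebraicClosure K) ∈ katoLayer p (Ideal.span {((f : ℕ) : 𝓞 K)}) s ∧ u.z s = η * r s) ∧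
      IsKatoUnitRep p ι₀ (Ideal.span {((f : ℕ) : 𝓞 K)}) s 𝔞 (u.z s) ∧
      CM.IsKatoUnitRepAt p (algClosureEmb ι₀) (Ideal.span {((f : ℕ) : 𝓞 K)}) s 𝔞 (u.z s) := by
  have h𝔣 : (Ideal.span {((f : ℕ) : 𝓞 K)} : Ideal (𝓞 K)) ≠ ⊥ := by
    rw [Ne, Ideal.span_singleton_eq_bot]
    exact_mod_cast hf.ne'
  have hV : ∀ s, F.V s = galFixing K (katoLayer p (Ideal.span {((f : ℕ) : 𝓞 K)}) s) :=
    V_eq_galFixing_katoLayer hM1 hM1' A hA K hK ψ hψA ι₀ f hf hcond p F hFV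
  -- (hr_fix) the representatives lie in `K(pˢ𝔣) = K̄^{V s}`
  have hr_fix : ∀ s, 1 ≤ s → ∀ σ : F.V s, (σ : absoluteGaloisGroup K) • r s = r s := fun s hs σ ↦
    Units.ext (by
      rw [Units.coe_smul]
      exact (mem_galFixing_iff K).mp ((hV s).le σ.2) _ (hr s hs).1.1)
  -- (hr_int) the `p`-unit conjunct, verbatim
  have hr_int : ∀ s, 1 ≤ s → ∃ k : ℕ,
      IsIntegral ℤ ((p : AlgebraicClosure K) ^ k * (r s : AlgebraicClosure K)) ∧
        IsIntegral ℤ ((p : AlgebraicClosure K) ^ k * ((r s)⁻¹ : (AlgebraicClosure K)ˣ).val) :=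
    fun s hs ↦ (hr s hs).1.2
  -- (hr_norm) coset norm = field norm = ζ · r s (de Shalit II.2.5 (i))
  have hr_norm : ∀ s, 1 ≤ s → ∃ ζ₀ : AlgebraicClosure K, ζ₀ ^ 12 = 1 ∧
      ((F.cosetNorm s (r (s + 1)) : (AlgebraicClosure K)ˣ) : AlgebraicClosure K) = ζ₀ * r s := by
    intro s hs
    obtain ⟨ζ, hζ, hN⟩ := exists_normOver_katoUnitRep_eq_mul p (Ideal.span {((f : ℕ) : 𝓞 K)}) h25 h24i hKiq ι₀ h𝔣 hs
      (hrig s hs) h𝔞 (hr s hs) (hr (s + 1) (by omega)) (hr (s + 1) (by omega)).1.1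
    haveI := F.finite_quotient_V s
    letI := Fintype.ofFinite (F.V s ⧸ (F.V (s + 1)).subgroupOf (F.V s))
    refine ⟨ζ, hζ, ?_⟩
    rw [F.coe_cosetNorm_eq_prod_smul s Quotient.out (fun x ↦ QuotientGroup.out_eq' x) (hr_fix (s + 1) (by omega)), ← hN]
    exact prod_smul_eq_normOver_of_eq (katoLayer_mono p _ h𝔣 (Nat.le_succ s)) (hV s) (hV (s + 1)) (s := Quotient.out)
      (fun x ↦ QuotientGroup.out_eq' x) ⟨(r (s + 1) : AlgebraicClosure K), (hr (s + 1) (by omega)).1.1⟩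
  obtain ⟨u, hu1, hu⟩ := F.exists_unitTower_of_reps (fun s hs ↦ coprime_card_quotient_of_frame _ f hf p hp F hFV hs) r hr_fix
    hr_norm hr_int
  refine ⟨u, hu1, fun s hs ↦ ?_⟩
  obtain ⟨η, hη, hηfix, hz⟩ := hu s hs
  have hηL : (η : AlgebraicClosure K) ∈ katoLayer p (Ideal.span {((f : ℕ) : 𝓞 K)}) s :=
    mem_of_forall_galFixing_smul_eq fun σ hσ ↦ congrArg Units.val (hηfix ⟨σ, (hV s).ge hσ⟩)
  have hrep : IsKatoUnitRep p ι₀ (Ideal.span {((f : ℕ) : 𝓞 K)}) s 𝔞 (u.z s) := by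
    rw [hz]
    exact isKatoUnitRep_mul_of_pow_twelve p hη hηL (hr s hs)
  exact ⟨⟨η, hη, hηL, hz⟩, hrep, (CM.isKatoUnitRepAt_algClosureEmb_iff p ι₀ _ s 𝔞 (u.z s)).mpr hrep⟩

/-- **The same on the torsion-tower frame `KummerFrame.ofTorsionTower A_K p f hf γ`** (`V s = Gal(K̄/K(A_K[pˢf]))` by `rfl`) — the
`_of_reps` companion of the D1045 (5) signature. [cite: Kato2004Asterisque, §15.5 (p. 253)] [cite: deShalit1987, II.2.5 Proposition (i)] -/
theorem exists_unitTower_of_katoReps_of_reps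
    (h25 : DeShalit1987.prop25_i_normRelation) (h24i : DeShalit1987.prop24_i_mem_rayClassField)
    (hM1 : CM.rayClassField_le_torsionField) (hM1' : CM.torsionField_le_rayClassField_of_conductor)
    (A : WeierstrassCurve ℚ) [A.IsElliptic] (hA : A.j ∈ maximalCMJInvariants)
    (K : Type) [Field K] [NumberField K] (hK : IsCMFieldOfJ K A.j) (hKiq : IsImaginaryQuadratic K)
    (ψ : HeckeCharacter K) (hψA : ∀ z : ℂ, 3 / 2 < z.re → heckeLFunction ψ z = A.LSeries z)
    (ι₀ : K →+* ℂ) (f : ℕ) (hf : 0 < f)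
    (hcond : ∀ α : 𝓞 K, α ≠ 0 → ((f : ℕ) : 𝓞 K) ∣ α - 1 →
      CM.heckeCharIdealValue ψ (Ideal.span {α}) = algClosureEmb ι₀ (algebraMap K (AlgebraicClosure K) (α : K)))
    (p : ℕ) [Fact p.Prime] (hp : p.Coprime 12)
    (hrig : ∀ n : ℕ, 1 ≤ n → UnitsInjectiveMod (katoModulus p (Ideal.span {((f : ℕ) : 𝓞 K)}) n))
    (γ : (A.baseChange K).tateModule p) (𝔞 : Ideal (𝓞 K)) (h𝔞 : IsTwist p (Ideal.span {((f : ℕ) : 𝓞 K)}) 𝔞)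
    (r : ℕ → (AlgebraicClosure K)ˣ) (hr : ∀ s : ℕ, 1 ≤ s → IsKatoUnitRep p ι₀ (Ideal.span {((f : ℕ) : 𝓞 K)}) s 𝔞 (r s)) :
    ∃ u : (KummerFrame.ofTorsionTower (A.baseChange K) p f hf γ).UnitTower, u.z 1 = r 1 ∧ ∀ s : ℕ, 1 ≤ s →
      (∃ η : (AlgebraicClosure K)ˣ, η ^ 12 = 1 ∧
        (η : AlgebraicClosure K) ∈ katoLayer p (Ideal.span {((f : ℕ) : 𝓞 K)}) s ∧ u.z s = η * r s) ∧
      IsKatoUnitRep p ι₀ (Ideal.span {((f : ℕ) : 𝓞 K)}) s 𝔞 (u.z s) ∧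
      CM.IsKatoUnitRepAt p (algClosureEmb ι₀) (Ideal.span {((f : ℕ) : 𝓞 K)}) s 𝔞 (u.z s) :=
  exists_unitTower_of_katoReps_of_frame_of_reps h25 h24i hM1 hM1' A hA K hK hKiq ψ hψA ι₀ f hf hcond p hp hrig _
    (KummerFrame.ofTorsionTower_V (A.baseChange K) p f hf γ) 𝔞 h𝔞 r hr

/-! ## §4 The unit tower from Kato §15.5 (`hE` forms: representatives chosen from `Kato2004.sec155_exists_katoUnitRep`) -/

/-- **`hE` form on any frame of the ray-class tower**: with the representatives supplied by Kato §15.5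
(`Kato2004.sec155_exists_katoUnitRep`, levels `≥ 1`), there is a unit tower on `F` pinned to Kato's units at every level `s ≥ 1`.
[cite: Kato2004Asterisque, §15.5 (p. 253)] [cite: deShalit1987, II.2.5 Proposition (i), II.2.4 (iii)] -/
theorem exists_unitTower_of_katoReps_of_frame
    (hE : Literature.NumberTheory.ComplexMultiplication.EllipticUnits.Kato2004.sec155_exists_katoUnitRep)
    (h25 : DeShalit1987.prop25_i_normRelation) (h24i : DeShalit1987.prop24_i_mem_rayClassField)
    (hM1 : CM.rayClassField_le_torsionField) (hM1' : CM.torsionField_le_rayClassField_of_conductor)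
    (A : WeierstrassCurve ℚ) [A.IsElliptic] (hA : A.j ∈ maximalCMJInvariants)
    (K : Type) [Field K] [NumberField K] (hK : IsCMFieldOfJ K A.j) (hKiq : IsImaginaryQuadratic K)
    (ψ : HeckeCharacter K) (hψA : ∀ z : ℂ, 3 / 2 < z.re → heckeLFunction ψ z = A.LSeries z)
    (ι₀ : K →+* ℂ) (f : ℕ) (hf : 0 < f)
    (hcond : ∀ α : 𝓞 K, α ≠ 0 → ((f : ℕ) : 𝓞 K) ∣ α - 1 →
      CM.heckeCharIdealValue ψ (Ideal.span {α}) = algClosureEmb ι₀ (algebraMap K (AlgebraicClosure K) (α : K)))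
    (p : ℕ) [Fact p.Prime] (hp : p.Coprime 12)
    (hrig : ∀ n : ℕ, 1 ≤ n → UnitsInjectiveMod (katoModulus p (Ideal.span {((f : ℕ) : 𝓞 K)}) n))
    (F : KummerFrame (A.baseChange K) p) (hFV : ∀ s : ℕ, F.V s = CM.torsionLayer (A.baseChange K) (p ^ s * f))
    (𝔞 : Ideal (𝓞 K)) (h𝔞 : IsTwist p (Ideal.span {((f : ℕ) : 𝓞 K)}) 𝔞) :
    ∃ u : F.UnitTower, ∀ s : ℕ, 1 ≤ s →
      IsKatoUnitRep p ι₀ (Ideal.span {((f : ℕ) : 𝓞 K)}) s 𝔞 (u.z s) ∧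
        CM.IsKatoUnitRepAt p (algClosureEmb ι₀) (Ideal.span {((f : ℕ) : 𝓞 K)}) s 𝔞 (u.z s) := by
  classical
  have h𝔣 : (Ideal.span {((f : ℕ) : 𝓞 K)} : Ideal (𝓞 K)) ≠ ⊥ := by
    rw [Ne, Ideal.span_singleton_eq_bot]
    exact_mod_cast hf.ne'
  -- Kato's representatives at the levels `≥ 1` (junk `1` at level `0`, never read)
  have hex : ∀ s : ℕ, 1 ≤ s → ∃ v : (AlgebraicClosure K)ˣ, IsKatoUnitRep p ι₀ (Ideal.span {((f : ℕ) : 𝓞 K)}) s 𝔞 v :=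
    fun s hs ↦ hE.exists_rep hKiq ι₀ h𝔣 hs (hrig s hs) h𝔞
  let r : ℕ → (AlgebraicClosure K)ˣ := fun s ↦ if hs : 1 ≤ s then (hex s hs).choose else 1
  have hr : ∀ s : ℕ, 1 ≤ s → IsKatoUnitRep p ι₀ (Ideal.span {((f : ℕ) : 𝓞 K)}) s 𝔞 (r s) := fun s hs ↦ by
    simp only [r, dif_pos hs]
    exact (hex s hs).choose_spec
  obtain ⟨u, -, hu⟩ := exists_unitTower_of_katoReps_of_frame_of_reps h25 h24i hM1 hM1' A hA K hK hKiq ψ hψA ι₀ f hf hcond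
    p hp hrig F hFV 𝔞 h𝔞 r hr
  exact ⟨u, fun s hs ↦ (hu s hs).2⟩

/-- ★ **`exists_unitTower_of_katoReps` — the signature of record (pen `bsd-cm` D1045 (5)): the unit-tower conjunct of `hF` in
`CM.prop159_ellipticUnits_expStar_values_of_kummerCup` on the torsion-tower frame `KummerFrame.ofTorsionTower A_K p f hf γ`.**
For `A/ℚ` with CM by the maximal order of the imaginary quadratic `K`, `ψ` with `L(ψ, s) = L(A, s)` and conductor dividing `(f)`,
a prime `p ∤ 12` with every level `pˢ𝔣` (`s ≥ 1`) rigid, `γ ∈ T_pA_K` and an admissible twist `𝔞`: there is a unit tower `u` on the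
frame whose units ARE Kato's `_𝔞z_{pˢ𝔣}` (`CM.IsKatoUnitRepAt p (algClosureEmb ι₀) (f) s 𝔞 (u.z s)`) at every `s ≥ 1` — granted
Kato §15.5 (`hE`), de Shalit II.2.5 (i)/II.2.4 (i) (`h25`, `h24i`) and the CM field identification (M1)/(M1′).
[cite: Kato2004Asterisque, §15.5 (p. 253)] [cite: deShalit1987, II.2.5 Proposition (i), II.2.4 (i)(iii), II.1.6]
[cite: SilvermanATAEC1994, Ch. II Thm. 5.6] -/
theorem exists_unitTower_of_katoReps
    (hE : Literature.NumberTheory.ComplexMultiplication.EllipticUnits.Kato2004.sec155_exists_katoUnitRep)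
    (h25 : DeShalit1987.prop25_i_normRelation) (h24i : DeShalit1987.prop24_i_mem_rayClassField)
    (hM1 : CM.rayClassField_le_torsionField) (hM1' : CM.torsionField_le_rayClassField_of_conductor)
    (A : WeierstrassCurve ℚ) [A.IsElliptic] (hA : A.j ∈ maximalCMJInvariants)
    (K : Type) [Field K] [NumberField K] (hK : IsCMFieldOfJ K A.j) (hKiq : IsImaginaryQuadratic K)
    (ψ : HeckeCharacter K) (hψA : ∀ z : ℂ, 3 / 2 < z.re → heckeLFunction ψ z = A.LSeries z)
    (ι₀ : K →+* ℂ) (f : ℕ) (hf : 0 < f)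
    (hcond : ∀ α : 𝓞 K, α ≠ 0 → ((f : ℕ) : 𝓞 K) ∣ α - 1 →
      CM.heckeCharIdealValue ψ (Ideal.span {α}) = algClosureEmb ι₀ (algebraMap K (AlgebraicClosure K) (α : K)))
    (p : ℕ) [Fact p.Prime] (hp : p.Coprime 12)
    (hrig : ∀ n : ℕ, 1 ≤ n → UnitsInjectiveMod (katoModulus p (Ideal.span {((f : ℕ) : 𝓞 K)}) n))
    (γ : (A.baseChange K).tateModule p) (𝔞 : Ideal (𝓞 K)) (h𝔞 : IsTwist p (Ideal.span {((f : ℕ) : 𝓞 K)}) 𝔞) :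
    ∃ u : (KummerFrame.ofTorsionTower (A.baseChange K) p f hf γ).UnitTower, ∀ s : ℕ, 1 ≤ s →
      CM.IsKatoUnitRepAt p (algClosureEmb ι₀) (Ideal.span {((f : ℕ) : 𝓞 K)}) s 𝔞 (u.z s) := by
  obtain ⟨u, hu⟩ := exists_unitTower_of_katoReps_of_frame hE h25 h24i hM1 hM1' A hA K hK hKiq ψ hψA ι₀ f hf hcond p hp hrig _
    (KummerFrame.ofTorsionTower_V (A.baseChange K) p f hf γ) 𝔞 h𝔞
  exact ⟨u, fun s hs ↦ (hu s hs).2⟩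

end Frame

end Summit.BirchSwinnertonDyer.Rank1Residual.Additive.GenusSeven.KummerUnitTower

end
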